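import Literature.AlgebraicTopology.SingularHomology.RelativeKronecker
import Literature.AlgebraicTopology.SingularHomology.TripleSequence
import HarnessLib

/-!
# Exactness for the cohomology of a triple over a field, by duality

Hatcher, *Algebraic Topology* (2002), §2.1 p. 118 (the long exact sequence of a triple
`B ⊆ A ⊆ X`) and §3.1 p. 199–201 (its cohomological form; with field coefficients `Hⁿ(-; F)` is
the dual of `Hₙ(-; F)`, Thm. 3.2). From the tree's homology exact sequence of the triple
(`relativeSingularHomology.triple_exact₁/₂/₃`) and the relative Kronecker isomorphism over a field
(`relKroneckerM_bijective_of_field`, naturality `relKroneckerM_map`) this file derives the two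
pieces of the COHOMOLOGY sequence of the triple that only involve maps of pairs:

* `relSingularCohomology_map_surjective_of_injective` — `f_*` one-to-one ⇒ `f^*` onto (dual of
  the tree's `relSingularCohomology_map_injective_of_surjective`);
* `relativeSingularHomology_map_val_injective_of_isZero` — `Hₙ(A, B) → Hₙ(X, B)` is one-to-one
  when `Hₙ₊₁(X, A) = 0`; hence `relSingularCohomology_map_val_surjective_of_isZero`:
  **restriction `Hⁿ(X, B; F) → Hⁿ(A, B; F)` is onto when `Hₙ₊₁(X, A; F) = 0`**;
* `exists_relSingularCohomology_map_id_eq_of_map_val_eq_zero` — **exactness of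
  `Hⁿ(X, A; F) → Hⁿ(X, B; F) → Hⁿ(A, B; F)` at the middle**: a class on `(X, B)` restricting to
  zero on `(A, B)` comes from `(X, A)`.

These are the "change of support" steps of the support calculus `Hⁿ(M | K) = Hⁿ(M, M ∖ K)`:
with `A = M ∖ K₁`, `B = M ∖ K` (`K₁ ⊆ K` closed), `(A, B)` is `(M ∖ K₁ | K ∖ K₁)`.

## References
* [HatcherAT2002] A. Hatcher, Algebraic Topology, CUP 2002, §2.1 p. 118; §3.1 Thm. 3.2, p. 199–201.

#harness_tags topology.singular_homology, topology.singular_cohomology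
-/

noncomputable section

open CategoryTheory Limits Set

universe u v

namespace Literature.AlgebraicTopology.SingularHomology

variable (F : Type v) [Field F]
variable {X Y : Type u} [TopologicalSpace X] [TopologicalSpace Y] {A : Set X} {B : Set Y} {m : ℕ}

/-! ### `f_*` one-to-one ⇒ `f^*` onto -/

/-- **If `f_*` is one-to-one on `Hₘ(-; F)` of the pairs then `f^*` is onto on `Hᵐ(-; F)`**
(Hatcher §3.1: over a field `f^*` is the dual of `f_*`; a functional on the source extends along
the injection `f_*`). [cite: HatcherAT2002, §3.1 Thm. 3.2 and p. 201] -/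
theorem relSingularCohomology_map_surjective_of_injective (f : C(X, Y)) (h : Set.MapsTo f A B)
    (hi : Function.Injective (relativeSingularHomology.map F F f h m)) :
    Function.Surjective (relSingularCohomology.map F F f h m) := by
  intro c
  -- extend the functional `⟨c, -⟩` along the injection `f_*`
  obtain ⟨g, hg⟩ := (relativeSingularHomology.map F F f h m).hom.exists_leftInverse_of_injective
    (LinearMap.ker_eq_bot.2 hi)
  obtain ⟨c', hc'⟩ := exists_relKroneckerM_eq F ((relKroneckerM F X A m c) ∘ₗ g)
  refine ⟨c', (relKroneckerM_bijective_of_field (X := X) F A m).1 (LinearMap.ext fun x ↦ ?_)⟩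
  rw [relKroneckerM_map, hc', LinearMap.comp_apply]
  have e := LinearMap.congr_fun hg x
  rw [LinearMap.comp_apply, LinearMap.id_apply] at e
  exact congrArg _ e

/-! ### Restriction to `(A, B)` -/

section Triple

variable {B' : Set X}

/-- **`Hₙ(A, B) → Hₙ(X, B)` is one-to-one when `Hₙ₊₁(X, A) = 0`** (`B ⊆ A ⊆ X`): exactness of
`Hₙ₊₁(X, A) → Hₙ(A, B) → Hₙ(X, B)` in the sequence of the triple (Hatcher p. 118).
[cite: HatcherAT2002, §2.1 p. 118] -/
theorem relativeSingularHomology_map_val_injective_of_isZero (R : Type v) [CommRing R] (M : Type v)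
    [AddCommGroup M] [Module R M] (hBA : B' ⊆ A) (n : ℕ)
    (hz : IsZero (relativeSingularHomology R M X A (n + 1))) :
    Function.Injective (relativeSingularHomology.map R M
      (⟨Subtype.val, continuous_subtype_val⟩ : C(↥A, X)) (mapsTo_val_preimage A B') n) := by
  have hex := (ShortComplex.ShortExact.moduleCat_exact_iff_function_exact _).1
    (relativeSingularHomology.triple_exact₁ R M hBA n)
  refine (injective_iff_map_eq_zero _).2 fun x hx ↦ ?_
  obtain ⟨y, rfl⟩ := (hex x).1 hx
  haveI := ModuleCat.subsingleton_of_isZero hz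
  have hy : y = 0 := Subsingleton.elim _ _
  rw [hy, map_zero]

/-- **Restriction `Hⁿ(X, B; F) → Hⁿ(A, B; F)` is onto when `Hₙ₊₁(X, A; F) = 0`** (`B ⊆ A ⊆ X`,
field coefficients): the dual of `relativeSingularHomology_map_val_injective_of_isZero`. In the
support calculus: `Hⁿ(M | K) → Hⁿ(M ∖ K₁ | K ∖ K₁)` is onto when `Hₙ₊₁(M | K₁) = 0`.
[cite: HatcherAT2002, §2.1 p. 118 and §3.1 p. 201] -/
theorem relSingularCohomology_map_val_surjective_of_isZero (hBA : B' ⊆ A) (n : ℕ)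
    (hz : IsZero (relativeSingularHomology F F X A (n + 1))) :
    Function.Surjective (relSingularCohomology.map F F
      (⟨Subtype.val, continuous_subtype_val⟩ : C(↥A, X)) (mapsTo_val_preimage A B') n) :=
  relSingularCohomology_map_surjective_of_injective F _ _
    (relativeSingularHomology_map_val_injective_of_isZero F F hBA n hz)

/-- **Exactness of `Hⁿ(X, A; F) → Hⁿ(X, B; F) → Hⁿ(A, B; F)` at the middle** (`B ⊆ A ⊆ X`,
field coefficients; Hatcher §3.1 p. 199–201, dual to the exactness of
`Hₙ(A, B) → Hₙ(X, B) → Hₙ(X, A)`): a class on `(X, B)` whose restriction to `(A, B)` vanishes is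
the image of a class on `(X, A)`. In the support calculus: a class of `Hⁿ(M | K)` vanishing in
`Hⁿ(M ∖ K₁ | K ∖ K₁)` comes from `Hⁿ(M | K₁)`. [cite: HatcherAT2002, §2.1 p. 118 and §3.1 p. 201] -/
theorem exists_relSingularCohomology_map_id_eq_of_map_val_eq_zero (hBA : B' ⊆ A) (n : ℕ)
    (c : relSingularCohomology F F X B' n)
    (hc : relSingularCohomology.map F F (⟨Subtype.val, continuous_subtype_val⟩ : C(↥A, X))
      (mapsTo_val_preimage A B') n c = 0) :
    ∃ c' : relSingularCohomology F F X A n,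
      relSingularCohomology.map F F (ContinuousMap.id X) (mapsTo_id_of_subset hBA) n c' = c := by
  set i := relativeSingularHomology.map F F (⟨Subtype.val, continuous_subtype_val⟩ : C(↥A, X))
    (mapsTo_val_preimage A B') n with hi
  set j := relativeSingularHomology.map F F (ContinuousMap.id X) (mapsTo_id_of_subset hBA) n with hj
  have hex := (ShortComplex.ShortExact.moduleCat_exact_iff_function_exact _).1
    (relativeSingularHomology.triple_exact₂ F F hBA n)
  -- the functional `φ = ⟨c, -⟩` on `Hₙ(X, B)` kills `im i_* = ker j_*`
  set φ : relativeSingularHomology F F X B' n →ₗ[F] F := relKroneckerM F X B' n c with hφ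
  have hφi : ∀ y, φ (i y) = 0 := fun y ↦ by
    rw [hφ, hi, ← relKroneckerM_map, hc, map_zero, LinearMap.zero_apply]
  have hker : LinearMap.ker j.hom ≤ LinearMap.ker φ := by
    intro x hx
    obtain ⟨y, rfl⟩ := (hex x).1 hx
    exact hφi y
  -- descend `φ` to `im j_*` and extend to `Hₙ(X, A)`
  let φbar : (relativeSingularHomology F F X B' n ⧸ LinearMap.ker j.hom) →ₗ[F] F :=
    (LinearMap.ker j.hom).liftQ φ hker
  let f₀ : LinearMap.range j.hom →ₗ[F] F := φbar ∘ₗ (j.hom.quotKerEquivRange).symm.toLinearMap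
  obtain ⟨ψ, hψ⟩ := LinearMap.exists_extend f₀
  have hψj : ∀ x, ψ (j x) = φ x := by
    intro x
    have hx : j.hom x ∈ LinearMap.range j.hom := LinearMap.mem_range_self _ x
    have e1 : ψ (j x) = f₀ ⟨j.hom x, hx⟩ := by
      rw [← hψ]; rfl
    rw [e1]
    change φbar ((j.hom.quotKerEquivRange).symm ⟨j.hom x, hx⟩) = φ x
    rw [LinearMap.quotKerEquivRange_symm_apply_image]
    rfl
  obtain ⟨c', hc'⟩ := exists_relKroneckerM_eq F ψ
  refine ⟨c', (relKroneckerM_bijective_of_field (X := X) F B' n).1 (LinearMap.ext fun x ↦ ?_)⟩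
  rw [relKroneckerM_map, hc']
  exact hψj x

end Triple

end Literature.AlgebraicTopology.SingularHomology
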